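/-
Copyright: the b2b-balaban T⁴-continuum CRUX team, row NE7b OWNER lineage `t4-ne7b-p1` (gen 141). Project licence.
-/
import Mathlib.Analysis.SpecialFunctions.Pow.Real

/-!
# ORDER FOUR BY CUTS: FROM THE SEVEN CUT BOUNDS TO THE SIXTEEN-TREE SUM (SCOPING (d13)(2), second file; Mathlib only).  For four sites
# `x, y, z, w` write `a, b, c, d, e, f` for the six edge weights `q_{xy}, q_{xz}, q_{xw}, q_{yz}, q_{yw}, q_{zw} ≥ 0` (the successor takes
# `q = ρ^{−β}`).  Each of the SEVEN bipartitions `S|Sᶜ` of the four sites (`{x}, {y}, {z}, {w}, {x,y}, {x,z}, {x,w}` against the rest) yields,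
# by (486) + Dobrushin + the two-point decay, a CUT BOUND `|u₄| ≤ C·(max_{e crossing S} q_e)³` (decay across the cut at a third of the rate).
# THIS FILE turns the seven cut bounds into the TREE bound
#   `|u₄| ≤ C·Σ_{T} Π_{e∈T} q_e`,   the sum over the SIXTEEN labelled spanning trees of the four sites (4 stars + 12 paths),
# whose row sums are volume-uniform (next file: each tree term sums to `≤ S³`).  THE ARGUMENT (a finite Prim∕threshold step): with
# `t = min_S max_{crossing} q`, every cut is crossed by an edge with `q ≥ t`; starting from `x`, three such crossings build a spanning tree with
# `Π q_e ≥ t³`; and `|u₄| ≤ C·t³` because `t` IS one of the seven maxima.  Also the moment–cumulant bookkeeping at `n = 4` for centred variables: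
# `u₄ = M − P₁₂P₃₄ − P₁₃P₂₄ − P₁₄P₂₃` is within `|M − P₁₂P₃₄| + |P₁₃||P₂₄| + |P₁₄||P₂₃|` (pair cut) and `|M| + Σ|P||P|` (single cut) (row NE7b,
# node U5c; Mathlib only; [folklore] — the distinguished-vertex argument of (461)∕(463) does NOT extend to order four: two far-apart close
# pairs defeat every single-vertex bound, whence cuts)

Cell `pub-balaban`, sub-cell `t4`, spine estimate NE7b (`T4WeightBudget.RelWeightBound`; the cell's OWN estimate — NOT PRINTED in
[Bałaban 1983–89], NOT PROVED).  Crux-route work under `Spine/NE7b/` by the row OWNER (`t4-ne7b-p1` gen 141, file (487)) under FREEZE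
(0)'s crux-prover clause; NOTHING of Bałaban's is named as a Lean object, valued or asserted; no `T4Continuum/Support` leaf typed; no
`def`, no notation (the sixteen-tree sum WRITTEN OUT); zero `sorry`.  Imports: Mathlib only (fast lane).

WHAT IS PROVED ([folklore]; `a … f, t, C ≥ 0`):
* §1 `abs_u4_le_pair_cut`, `abs_u4_le_single_cut` (the moment–cumulant triangle inequalities at `n = 4`).
* §2 `cube_le_prod`, **`cube_le_tree_sum_of_strong`** (the Prim step from a strong edge at `x`: twelve leaves), **`cube_min_le_tree_sum`** (all seven
  cuts crossed by a `q ≥ t` edge ⟹ `t³ ≤ Σ_TΠq`; the three choices of the first edge by relabelling).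
* §3 THE END **`four_point_cut_tree`** (`|u| ≤ C·(max crossing q)³` for the seven cuts ⟹ `|u| ≤ C·Σ_TΠ_{e∈T}q_e`); §4 toy.

HONEST (what this is NOT).  Finite combinatorics of four points; the cut bounds themselves ((486) ⊕ Dobrushin for two clamped products ⊕ sixth
moments ⊕ the two-point decay, with `R` a power of `ρ`), the row sums of the tree sum and the `u₄` kernel letter are the next files; orders
five and the cumulant form of `∂⁴W` NOT typed; scalar skeleton ((A3), NC-NE7b-α UNRULED); nothing of Bałaban's asserted.  BY-NAME EFFECT ON THE
WALL: NONE.  NE7b NOT PRINTED ∕ NOT PROVED; spine PROVED 0∕9; rung (B)+1 — the programme's measures remain FINITE-torus statements; NOT the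
mass gap, NOT Clay.  HONEST DEPENDENCY: continuum YM on T⁴ ⇐ BetaPertH ∧ nine spine estimates (0∕9 proved); BetaPertH ⇐ (D1) ∧ (D4) ∧
CAP+tail; G-an2-4 gates asym, D1 and NE2∕3∕4.
-/

set_option autoImplicit false

namespace Summit.QuantumFields.BalabanUV.T4Continuum.NE7b.SupFourPointCutTree

/-! ## §1. The moment–cumulant triangle inequalities at `n = 4` (centred variables) -/

/-- **Pair cut**: `|M − P₁₂P₃₄ − P₁₃P₂₄ − P₁₄P₂₃| ≤ |M − P₁₂P₃₄| + |P₁₃|·|P₂₄| + |P₁₄|·|P₂₃|`. [folklore] -/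
theorem abs_u4_le_pair_cut (M P12 P34 P13 P24 P14 P23 : ℝ) :
    |M - P12 * P34 - P13 * P24 - P14 * P23| ≤ |M - P12 * P34| + |P13| * |P24| + |P14| * |P23| := by
  have h1 := abs_sub (M - P12 * P34 - P13 * P24) (P14 * P23)
  have h2 := abs_sub (M - P12 * P34) (P13 * P24)
  rw [abs_mul] at h1 h2
  linarith

/-- **Single cut**: `|M − P₁₂P₃₄ − P₁₃P₂₄ − P₁₄P₂₃| ≤ |M| + |P₁₂|·|P₃₄| + |P₁₃|·|P₂₄| + |P₁₄|·|P₂₃|`. [folklore] -/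
theorem abs_u4_le_single_cut (M P12 P34 P13 P24 P14 P23 : ℝ) :
    |M - P12 * P34 - P13 * P24 - P14 * P23| ≤ |M| + |P12| * |P34| + |P13| * |P24| + |P14| * |P23| := by
  have h1 := abs_u4_le_pair_cut M P12 P34 P13 P24 P14 P23
  have h2 := abs_sub M (P12 * P34)
  rw [abs_mul] at h2
  linarith

/-! ## §2. The Prim step: a cube below the sixteen-tree sum -/

/-- `t ≤ p, q, r` (`t ≥ 0`) gives `t³ ≤ pqr`. [folklore] -/
theorem cube_le_prod {t : ℝ} (ht : 0 ≤ t) (p q r : ℝ) (hp : t ≤ p) (hq : t ≤ q) (hr : t ≤ r) : t ^ 3 ≤ p * q * r := by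
  have hp0 : 0 ≤ p := ht.trans hp
  have hq0 : 0 ≤ q := ht.trans hq
  calc t ^ 3 = t * t * t := by ring
    _ ≤ p * q * r := mul_le_mul (mul_le_mul hp hq ht hp0) hr ht (mul_nonneg hp0 hq0)

/-- **The Prim step from a strong edge `xy`**: if `t ≤ a` (= `q_{xy}`), the cut `{x,y}|{z,w}` is crossed by an edge `≥ t`, and so are the
cuts `{z}|·` and `{w}|·`, then `t³ ≤ Σ_TΠ_{e∈T}q_e` (three strong edges form one of the sixteen trees). [folklore] -/
theorem cube_le_tree_sum_of_strong {t a b c d e f : ℝ} (ht : 0 ≤ t) (ha : 0 ≤ a) (hb : 0 ≤ b) (hc : 0 ≤ c) (hd : 0 ≤ d) (he : 0 ≤ e) (hf : 0 ≤ f)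
    (hxy : t ≤ a) (hSxy : t ≤ b ∨ t ≤ c ∨ t ≤ d ∨ t ≤ e) (hSz : t ≤ b ∨ t ≤ d ∨ t ≤ f) (hSw : t ≤ c ∨ t ≤ e ∨ t ≤ f) :
    t ^ 3 ≤ a * b * c + a * d * e + b * d * f + c * e * f + a * d * f + a * e * f + b * d * e + b * e * f + c * d * e + c * d * f + a * b * f + a * c
        * f + a * b * e + b * c * e + a * c * d + b * c * d := by
  have cube := fun (p q r : ℝ) (hp : t ≤ p) (hq : t ≤ q) (hr : t ≤ r) => cube_le_prod ht p q r hp hq hr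
  rcases hSxy with hb' | hc' | hd' | he'
  · -- second edge `xz`; the remaining site `w` attaches by `xw`, `yw` or `zw`
    rcases hSw with hc'' | he'' | hf''
    · linarith [cube a b c hxy hb' hc'', mul_nonneg (mul_nonneg ha hb) hc, mul_nonneg (mul_nonneg ha hd) he, mul_nonneg (mul_nonneg hb hd) hf,
        mul_nonneg (mul_nonneg hc he) hf, mul_nonneg (mul_nonneg ha hd) hf, mul_nonneg (mul_nonneg ha he) hf, mul_nonneg (mul_nonneg hb hd) he,
        mul_nonneg (mul_nonneg hb he) hf, mul_nonneg (mul_nonneg hc hd) he, mul_nonneg (mul_nonneg hc hd) hf, mul_nonneg (mul_nonneg ha hb) hf,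
        mul_nonneg (mul_nonneg ha hc) hf, mul_nonneg (mul_nonneg ha hb) he, mul_nonneg (mul_nonneg hb hc) he, mul_nonneg (mul_nonneg ha hc) hd,
        mul_nonneg (mul_nonneg hb hc) hd]
    · linarith [cube a b e hxy hb' he'', mul_nonneg (mul_nonneg ha hb) hc, mul_nonneg (mul_nonneg ha hd) he, mul_nonneg (mul_nonneg hb hd) hf,
        mul_nonneg (mul_nonneg hc he) hf, mul_nonneg (mul_nonneg ha hd) hf, mul_nonneg (mul_nonneg ha he) hf, mul_nonneg (mul_nonneg hb hd) he,
        mul_nonneg (mul_nonneg hb he) hf, mul_nonneg (mul_nonneg hc hd) he, mul_nonneg (mul_nonneg hc hd) hf, mul_nonneg (mul_nonneg ha hb) hf,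
        mul_nonneg (mul_nonneg ha hc) hf, mul_nonneg (mul_nonneg ha hb) he, mul_nonneg (mul_nonneg hb hc) he, mul_nonneg (mul_nonneg ha hc) hd,
        mul_nonneg (mul_nonneg hb hc) hd]
    · linarith [cube a b f hxy hb' hf'', mul_nonneg (mul_nonneg ha hb) hc, mul_nonneg (mul_nonneg ha hd) he, mul_nonneg (mul_nonneg hb hd) hf,
        mul_nonneg (mul_nonneg hc he) hf, mul_nonneg (mul_nonneg ha hd) hf, mul_nonneg (mul_nonneg ha he) hf, mul_nonneg (mul_nonneg hb hd) he,
        mul_nonneg (mul_nonneg hb he) hf, mul_nonneg (mul_nonneg hc hd) he, mul_nonneg (mul_nonneg hc hd) hf, mul_nonneg (mul_nonneg ha hb) hf,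
        mul_nonneg (mul_nonneg ha hc) hf, mul_nonneg (mul_nonneg ha hb) he, mul_nonneg (mul_nonneg hb hc) he, mul_nonneg (mul_nonneg ha hc) hd,
        mul_nonneg (mul_nonneg hb hc) hd]
  · -- second edge `xw`; the remaining site `z` attaches by `xz`, `yz` or `zw`
    rcases hSz with hb'' | hd'' | hf''
    · linarith [cube a b c hxy hb'' hc', mul_nonneg (mul_nonneg ha hb) hc, mul_nonneg (mul_nonneg ha hd) he, mul_nonneg (mul_nonneg hb hd) hf,
        mul_nonneg (mul_nonneg hc he) hf, mul_nonneg (mul_nonneg ha hd) hf, mul_nonneg (mul_nonneg ha he) hf, mul_nonneg (mul_nonneg hb hd) he,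
        mul_nonneg (mul_nonneg hb he) hf, mul_nonneg (mul_nonneg hc hd) he, mul_nonneg (mul_nonneg hc hd) hf, mul_nonneg (mul_nonneg ha hb) hf,
        mul_nonneg (mul_nonneg ha hc) hf, mul_nonneg (mul_nonneg ha hb) he, mul_nonneg (mul_nonneg hb hc) he, mul_nonneg (mul_nonneg ha hc) hd,
        mul_nonneg (mul_nonneg hb hc) hd]
    · linarith [cube a c d hxy hc' hd'', mul_nonneg (mul_nonneg ha hb) hc, mul_nonneg (mul_nonneg ha hd) he, mul_nonneg (mul_nonneg hb hd) hf,
        mul_nonneg (mul_nonneg hc he) hf, mul_nonneg (mul_nonneg ha hd) hf, mul_nonneg (mul_nonneg ha he) hf, mul_nonneg (mul_nonneg hb hd) he,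
        mul_nonneg (mul_nonneg hb he) hf, mul_nonneg (mul_nonneg hc hd) he, mul_nonneg (mul_nonneg hc hd) hf, mul_nonneg (mul_nonneg ha hb) hf,
        mul_nonneg (mul_nonneg ha hc) hf, mul_nonneg (mul_nonneg ha hb) he, mul_nonneg (mul_nonneg hb hc) he, mul_nonneg (mul_nonneg ha hc) hd,
        mul_nonneg (mul_nonneg hb hc) hd]
    · linarith [cube a c f hxy hc' hf'', mul_nonneg (mul_nonneg ha hb) hc, mul_nonneg (mul_nonneg ha hd) he, mul_nonneg (mul_nonneg hb hd) hf,
        mul_nonneg (mul_nonneg hc he) hf, mul_nonneg (mul_nonneg ha hd) hf, mul_nonneg (mul_nonneg ha he) hf, mul_nonneg (mul_nonneg hb hd) he,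
        mul_nonneg (mul_nonneg hb he) hf, mul_nonneg (mul_nonneg hc hd) he, mul_nonneg (mul_nonneg hc hd) hf, mul_nonneg (mul_nonneg ha hb) hf,
        mul_nonneg (mul_nonneg ha hc) hf, mul_nonneg (mul_nonneg ha hb) he, mul_nonneg (mul_nonneg hb hc) he, mul_nonneg (mul_nonneg ha hc) hd,
        mul_nonneg (mul_nonneg hb hc) hd]
  · -- second edge `yz`; the remaining site `w` attaches by `xw`, `yw` or `zw`
    rcases hSw with hc'' | he'' | hf''
    · linarith [cube a c d hxy hc'' hd', mul_nonneg (mul_nonneg ha hb) hc, mul_nonneg (mul_nonneg ha hd) he, mul_nonneg (mul_nonneg hb hd) hf,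
        mul_nonneg (mul_nonneg hc he) hf, mul_nonneg (mul_nonneg ha hd) hf, mul_nonneg (mul_nonneg ha he) hf, mul_nonneg (mul_nonneg hb hd) he,
        mul_nonneg (mul_nonneg hb he) hf, mul_nonneg (mul_nonneg hc hd) he, mul_nonneg (mul_nonneg hc hd) hf, mul_nonneg (mul_nonneg ha hb) hf,
        mul_nonneg (mul_nonneg ha hc) hf, mul_nonneg (mul_nonneg ha hb) he, mul_nonneg (mul_nonneg hb hc) he, mul_nonneg (mul_nonneg ha hc) hd,
        mul_nonneg (mul_nonneg hb hc) hd]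
    · linarith [cube a d e hxy hd' he'', mul_nonneg (mul_nonneg ha hb) hc, mul_nonneg (mul_nonneg ha hd) he, mul_nonneg (mul_nonneg hb hd) hf,
        mul_nonneg (mul_nonneg hc he) hf, mul_nonneg (mul_nonneg ha hd) hf, mul_nonneg (mul_nonneg ha he) hf, mul_nonneg (mul_nonneg hb hd) he,
        mul_nonneg (mul_nonneg hb he) hf, mul_nonneg (mul_nonneg hc hd) he, mul_nonneg (mul_nonneg hc hd) hf, mul_nonneg (mul_nonneg ha hb) hf,
        mul_nonneg (mul_nonneg ha hc) hf, mul_nonneg (mul_nonneg ha hb) he, mul_nonneg (mul_nonneg hb hc) he, mul_nonneg (mul_nonneg ha hc) hd,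
        mul_nonneg (mul_nonneg hb hc) hd]
    · linarith [cube a d f hxy hd' hf'', mul_nonneg (mul_nonneg ha hb) hc, mul_nonneg (mul_nonneg ha hd) he, mul_nonneg (mul_nonneg hb hd) hf,
        mul_nonneg (mul_nonneg hc he) hf, mul_nonneg (mul_nonneg ha hd) hf, mul_nonneg (mul_nonneg ha he) hf, mul_nonneg (mul_nonneg hb hd) he,
        mul_nonneg (mul_nonneg hb he) hf, mul_nonneg (mul_nonneg hc hd) he, mul_nonneg (mul_nonneg hc hd) hf, mul_nonneg (mul_nonneg ha hb) hf,
        mul_nonneg (mul_nonneg ha hc) hf, mul_nonneg (mul_nonneg ha hb) he, mul_nonneg (mul_nonneg hb hc) he, mul_nonneg (mul_nonneg ha hc) hd,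
        mul_nonneg (mul_nonneg hb hc) hd]
  · -- second edge `yw`; the remaining site `z` attaches by `xz`, `yz` or `zw`
    rcases hSz with hb'' | hd'' | hf''
    · linarith [cube a b e hxy hb'' he', mul_nonneg (mul_nonneg ha hb) hc, mul_nonneg (mul_nonneg ha hd) he, mul_nonneg (mul_nonneg hb hd) hf,
        mul_nonneg (mul_nonneg hc he) hf, mul_nonneg (mul_nonneg ha hd) hf, mul_nonneg (mul_nonneg ha he) hf, mul_nonneg (mul_nonneg hb hd) he,
        mul_nonneg (mul_nonneg hb he) hf, mul_nonneg (mul_nonneg hc hd) he, mul_nonneg (mul_nonneg hc hd) hf, mul_nonneg (mul_nonneg ha hb) hf,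
        mul_nonneg (mul_nonneg ha hc) hf, mul_nonneg (mul_nonneg ha hb) he, mul_nonneg (mul_nonneg hb hc) he, mul_nonneg (mul_nonneg ha hc) hd,
        mul_nonneg (mul_nonneg hb hc) hd]
    · linarith [cube a d e hxy hd'' he', mul_nonneg (mul_nonneg ha hb) hc, mul_nonneg (mul_nonneg ha hd) he, mul_nonneg (mul_nonneg hb hd) hf,
        mul_nonneg (mul_nonneg hc he) hf, mul_nonneg (mul_nonneg ha hd) hf, mul_nonneg (mul_nonneg ha he) hf, mul_nonneg (mul_nonneg hb hd) he,
        mul_nonneg (mul_nonneg hb he) hf, mul_nonneg (mul_nonneg hc hd) he, mul_nonneg (mul_nonneg hc hd) hf, mul_nonneg (mul_nonneg ha hb) hf,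
        mul_nonneg (mul_nonneg ha hc) hf, mul_nonneg (mul_nonneg ha hb) he, mul_nonneg (mul_nonneg hb hc) he, mul_nonneg (mul_nonneg ha hc) hd,
        mul_nonneg (mul_nonneg hb hc) hd]
    · linarith [cube a e f hxy he' hf'', mul_nonneg (mul_nonneg ha hb) hc, mul_nonneg (mul_nonneg ha hd) he, mul_nonneg (mul_nonneg hb hd) hf,
        mul_nonneg (mul_nonneg hc he) hf, mul_nonneg (mul_nonneg ha hd) hf, mul_nonneg (mul_nonneg ha he) hf, mul_nonneg (mul_nonneg hb hd) he,
        mul_nonneg (mul_nonneg hb he) hf, mul_nonneg (mul_nonneg hc hd) he, mul_nonneg (mul_nonneg hc hd) hf, mul_nonneg (mul_nonneg ha hb) hf,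
        mul_nonneg (mul_nonneg ha hc) hf, mul_nonneg (mul_nonneg ha hb) he, mul_nonneg (mul_nonneg hb hc) he, mul_nonneg (mul_nonneg ha hc) hd,
        mul_nonneg (mul_nonneg hb hc) hd]

/-- **Every cut crossed by a strong edge ⟹ `t³ ≤ Σ_TΠq`** (`t ≥ 0`; the first strong edge at `x` is `xy`, `xz` or `xw` — the last two by
relabelling `y ↔ z`, `y ↦ w ↦ z ↦ y` in the previous lemma; the tree sum is invariant). [folklore] -/
theorem cube_min_le_tree_sum {t a b c d e f : ℝ} (ht : 0 ≤ t) (ha : 0 ≤ a) (hb : 0 ≤ b) (hc : 0 ≤ c) (hd : 0 ≤ d) (he : 0 ≤ e) (hf : 0 ≤ f)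
    (hSx : t ≤ a ∨ t ≤ b ∨ t ≤ c) (hSy : t ≤ a ∨ t ≤ d ∨ t ≤ e) (hSz : t ≤ b ∨ t ≤ d ∨ t ≤ f) (hSw : t ≤ c ∨ t ≤ e ∨ t ≤ f)
    (hSxy : t ≤ b ∨ t ≤ c ∨ t ≤ d ∨ t ≤ e) (hSxz : t ≤ a ∨ t ≤ c ∨ t ≤ d ∨ t ≤ f) (hSxw : t ≤ a ∨ t ≤ b ∨ t ≤ e ∨ t ≤ f) :
    t ^ 3 ≤ a * b * c + a * d * e + b * d * f + c * e * f + a * d * f + a * e * f + b * d * e + b * e * f + c * d * e + c * d * f + a * b * f + a * c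
        * f + a * b * e + b * c * e + a * c * d + b * c * d := by
  rcases hSx with ha' | hb' | hc'
  · exact cube_le_tree_sum_of_strong ht ha hb hc hd he hf ha' hSxy hSz hSw
  · -- first edge `xz`: relabel `y ↔ z` (`a ↔ b`, `e ↔ f`)
    have h := cube_le_tree_sum_of_strong (a := b) (b := a) (c := c) (d := d) (e := f) (f := e) ht hb ha hc hd hf he hb' hSxz hSy (hSw.imp id Or.symm)
    have eq : b * a * c + b * d * f + a * d * e + c * f * e + b * d * e + b * f * e + a * d * f + a * f * e + c * d * f + c * d * e + b * a * e + b *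
        c * e + b * a * f + a * c * f + b * c * d + a * c * d =
        a * b * c + a * d * e + b * d * f + c * e * f + a * d * f + a * e * f + b * d * e + b * e * f + c * d * e + c * d * f + a * b * f + a * c * f
            + a * b * e + b * c * e + a * c * d + b * c * d := by ring
    linarith
  · -- first edge `xw`: relabel `y ↦ w`, `z ↦ y`, `w ↦ z` (`a ↦ c ↦ b ↦ a`, `d ↦ e ↦ f ↦ d`)
    have h := cube_le_tree_sum_of_strong (a := c) (b := a) (c := b) (d := e) (e := f) (f := d) ht hc ha hb he hf hd hc' hSxw (hSy.imp id Or.symm)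
      (hSz.imp id Or.symm)
    have eq : c * a * b + c * e * f + a * e * d + b * f * d + c * e * d + c * f * d + a * e * f + a * f * d + b * e * f + b * e * d + c * a * d + c *
        b * d + c * a * f + a * b * f + c * b * e + a * b * e =
        a * b * c + a * d * e + b * d * f + c * e * f + a * d * f + a * e * f + b * d * e + b * e * f + c * d * e + c * d * f + a * b * f + a * c * f
            + a * b * e + b * c * e + a * c * d + b * c * d := by ring
    linarith

/-! ## §3. THE END: from the seven cut bounds to the tree bound -/

/-- **THE END — ORDER FOUR BY CUTS**: if `|u| ≤ C·(max_{e crossing S} q_e)³` for each of the seven cuts `S` of four sites (`C, q ≥ 0`), then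
`|u| ≤ C·Σ_TΠ_{e∈T}q_e` over the sixteen labelled spanning trees. [folklore] -/
theorem four_point_cut_tree {u C a b c d e f : ℝ} (hC : 0 ≤ C) (ha : 0 ≤ a) (hb : 0 ≤ b) (hc : 0 ≤ c) (hd : 0 ≤ d) (he : 0 ≤ e) (hf : 0 ≤ f)
    (h1 : |u| ≤ C * (max a (max b c)) ^ 3) (h2 : |u| ≤ C * (max a (max d e)) ^ 3) (h3 : |u| ≤ C * (max b (max d f)) ^ 3)
    (h4 : |u| ≤ C * (max c (max e f)) ^ 3) (h5 : |u| ≤ C * (max b (max c (max d e))) ^ 3) (h6 : |u| ≤ C * (max a (max c (max d f))) ^ 3)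
    (h7 : |u| ≤ C * (max a (max b (max e f))) ^ 3) :
    |u| ≤ C * (a * b * c + a * d * e + b * d * f + c * e * f + a * d * f + a * e * f + b * d * e + b * e * f + c * d * e + c * d * f + a * b * f + a
        * c * f + a * b * e + b * c * e + a * c * d + b * c * d) := by
  -- `t` = the least of the seven maxima
  set t : ℝ := min (max a (max b c)) (min (max a (max d e)) (min (max b (max d f)) (min (max c (max e f)) (min (max b (max c (max d e)))
    (min (max a (max c (max d f))) (max a (max b (max e f)))))))) with htdef
  have ht0 : 0 ≤ t := by
    refine le_min (ha.trans (le_max_left _ _)) (le_min (ha.trans (le_max_left _ _)) (le_min (hb.trans (le_max_left _ _))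
      (le_min (hc.trans (le_max_left _ _)) (le_min (hb.trans (le_max_left _ _)) (le_min (ha.trans (le_max_left _ _)) (ha.trans (le_max_left _ _)))))))
  -- `|u| ≤ C·t³`: `t` is one of the seven
  have hut : |u| ≤ C * t ^ 3 := by
    rw [htdef]
    rcases min_choice (max a (max b c)) (min (max a (max d e)) (min (max b (max d f)) (min (max c (max e f)) (min (max b (max c (max d e)))
      (min (max a (max c (max d f))) (max a (max b (max e f)))))))) with h | h <;> rw [h]
    · exact h1
    rcases min_choice (max a (max d e)) (min (max b (max d f)) (min (max c (max e f)) (min (max b (max c (max d e)))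
      (min (max a (max c (max d f))) (max a (max b (max e f))))))) with h | h <;> rw [h]
    · exact h2
    rcases min_choice (max b (max d f)) (min (max c (max e f)) (min (max b (max c (max d e))) (min (max a (max c (max d f)))
      (max a (max b (max e f)))))) with h | h <;> rw [h]
    · exact h3
    rcases min_choice (max c (max e f)) (min (max b (max c (max d e))) (min (max a (max c (max d f))) (max a (max b (max e f))))) with h | h <;>
      rw [h]
    · exact h4
    rcases min_choice (max b (max c (max d e))) (min (max a (max c (max d f))) (max a (max b (max e f)))) with h | h <;> rw [h]
    · exact h5
    rcases min_choice (max a (max c (max d f))) (max a (max b (max e f))) with h | h <;> rw [h]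
    · exact h6
    · exact h7
  -- every cut is crossed by an edge with `q ≥ t`
  have l1 : t ≤ max a (max b c) := min_le_left _ _
  have l2 : t ≤ max a (max d e) := (min_le_right _ _).trans (min_le_left _ _)
  have l3 : t ≤ max b (max d f) := (min_le_right _ _).trans ((min_le_right _ _).trans (min_le_left _ _))
  have l4 : t ≤ max c (max e f) := (min_le_right _ _).trans ((min_le_right _ _).trans ((min_le_right _ _).trans (min_le_left _ _)))
  have l5 : t ≤ max b (max c (max d e)) :=
    (min_le_right _ _).trans ((min_le_right _ _).trans ((min_le_right _ _).trans ((min_le_right _ _).trans (min_le_left _ _))))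
  have l6 : t ≤ max a (max c (max d f)) :=
    (min_le_right _ _).trans ((min_le_right _ _).trans ((min_le_right _ _).trans ((min_le_right _ _).trans ((min_le_right _ _).trans (min_le_left _
        _)))))
  have l7 : t ≤ max a (max b (max e f)) :=
    (min_le_right _ _).trans ((min_le_right _ _).trans ((min_le_right _ _).trans ((min_le_right _ _).trans ((min_le_right _ _).trans (min_le_right _
        _)))))
  simp only [le_max_iff] at l1 l2 l3 l4 l5 l6 l7
  have htree := cube_min_le_tree_sum ht0 ha hb hc hd he hf l1 l2 l3 l4 l5 l6 l7
  exact hut.trans (mul_le_mul_of_nonneg_left htree hC)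

/-! ## §4. Toy -/

/-- Toy (§2 at unit weights): `1³ ≤ 16`. -/
example : (1 : ℝ) ^ 3 ≤ 1 * 1 * 1 + 1 * 1 * 1 + 1 * 1 * 1 + 1 * 1 * 1 + 1 * 1 * 1 + 1 * 1 * 1 + 1 * 1 * 1 + 1 * 1 * 1 + 1 * 1 * 1 + 1 * 1 * 1 + 1 * 1
    * 1 + 1 * 1 * 1 + 1 * 1 * 1 + 1 * 1 * 1 + 1 * 1 * 1 + 1 * 1 * 1 := by norm_num

end Summit.QuantumFields.BalabanUV.T4Continuum.NE7b.SupFourPointCutTree
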